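import Mathlib.Data.Matrix.Mul
import Mathlib.LinearAlgebra.FiniteDimensional.Lemmas
import HarnessLib

/-!
# Route `PhantomRMYoshida`, crux `ResiduallyYoshidaLifting` (stmt-Langlands-13639), line `sector-klingen-split`:
# stub GL `stub_greenbergDecIntrinsic` — the decomposition-group Greenberg condition is linear, contains the
# coboundaries, and its lines are unique

The registered sub-goal `stub_greenbergDecIntrinsic` of the checked skeleton (rev 14, lead c5-0).  Setting: a field `k`,
families `S, S' : ι → M₂(k)` (think `σ̄(res τ)`, `σ̄'(res τ)` for `τ` in a decomposition group), an inertia predicate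
`I : ι → Prop`, and fixed vectors `x₁, y₁ : k²` (the Greenberg lines).  For a cocycle `A : ι → M₂(k)` with correction
`X : M₂(k)` write `A' i := A i - (S i X - X S' i)`; the `A`-dependent clauses of the decomposition-group Greenberg–Selmer
condition are `A' i y₁ ∈ k x₁` for all `i`, and `A' i y₁ = 0`, `A' i (k²) ⊆ k x₁` for `i ∈ I`.

Claims.
* (LIN) the three clauses pass from `(A₁, X₁)`, `(A₂, X₂)` to `(c • A₁ + A₂, c • X₁ + X₂)`: the corrected matrix is
  `c • A₁' i + A₂' i` (bilinearity of `S i X - X S' i` in `X`), and witnesses combine as `c * e₁ + e₂`.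
* (COB) they hold for every coboundary `(S X - X S', X)`: the corrected matrix is `0`.
* (UNIQ) if some inertia element moves `σ̄` (`S i₀ ≠ 1`, `I i₀`), a non-zero inertia-fixed `x₁` spans the whole fixed
  space: `T := S i₀ - 1 ≠ 0` kills `x₁` and any fixed `x`, and the kernel of a non-zero `2 × 2` matrix lies in a line
  (two independent kernel vectors would span `k²` and force `T = 0`).  Likewise for `σ̄'`, `y₁`.

No new definitions; the two helper lemmas are private.  Mathlib only.
-/

noncomputable section

-- `Summit.Langlands.Langlands.…` (summit = sub-problem name, D-0017 layout) trips `dupNamespace` on every decl;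
-- project-wide option (lakefile `weak.linter.dupNamespace = false`).
set_option linter.dupNamespace false
set_option autoImplicit false

open scoped Matrix

namespace Summit.Langlands.Langlands.Cruxes.ResiduallyYoshidaLifting.SectorKlingenSplit.Fibre

/-- The kernel of a non-zero `2 × 2` matrix over a field is contained in a line: if `Q ≠ 0`, `Q c = 0` with `c ≠ 0`
and `Q d = 0`, then `d ∈ k c` (otherwise `c, d` form a basis of `k²` killed by `Q`, forcing `Q = 0`). [folklore] -/
-- adapted from Theorems/PhantomRMYoshidaResiduallyYoshidaLiftingGreenbergLinesDistinguished.lean (private there)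
private theorem exists_eq_smul_of_mulVec_eq_zero {k : Type*} [Field k] (Q : Matrix (Fin 2) (Fin 2) k) (hQ : Q ≠ 0)
    {c d : Fin 2 → k} (hc : c ≠ 0) (hQc : Q *ᵥ c = 0) (hQd : Q *ᵥ d = 0) : ∃ μ : k, d = μ • c := by
  by_contra hne
  push Not at hne
  have hli : LinearIndependent k ![c, d] := by
    refine LinearIndependent.pair_iff.2 fun s t hst ↦ ?_
    by_cases ht : t = 0
    · rw [ht, zero_smul, add_zero] at hst
      exact ⟨(smul_eq_zero.1 hst).resolve_right hc, ht⟩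
    · refine absurd ?_ (hne (-(t⁻¹ * s)))
      have h1 : t • d = -(s • c) := eq_neg_of_add_eq_zero_right hst
      calc d = t⁻¹ • (t • d) := by rw [smul_smul, inv_mul_cancel₀ ht, one_smul]
        _ = -(t⁻¹ * s) • c := by rw [h1, smul_neg, smul_smul, neg_smul]
  let bs := basisOfLinearIndependentOfCardEqFinrank hli (by simp)
  have hb : ⇑bs = ![c, d] := coe_basisOfLinearIndependentOfCardEqFinrank _ _
  refine hQ (Matrix.ext_iff_mulVec.mpr fun v ↦ ?_)
  obtain ⟨α, β, rfl⟩ : ∃ α β : k, v = α • c + β • d :=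
    ⟨bs.repr v 0, bs.repr v 1, by conv_lhs => rw [← bs.sum_repr v, Fin.sum_univ_two, hb]; simp⟩
  rw [Matrix.mulVec_add, Matrix.mulVec_smul, Matrix.mulVec_smul, hQc, hQd, smul_zero, smul_zero, add_zero,
    Matrix.zero_mulVec]

/-- Uniqueness of the fixed line of a family: if some `S i₀ ≠ 1` with `I i₀`, and `x₁ ≠ 0` is fixed by every `S i`
(`i ∈ I`), then every `x` fixed by every `S i` (`i ∈ I`) lies in `k x₁` (both lie in the kernel of the non-zero
`2 × 2` matrix `S i₀ - 1`, which is contained in a line). [folklore] -/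
private theorem exists_eq_smul_of_fixed {k : Type*} [Field k] {ι : Type*} (I : ι → Prop)
    (S : ι → Matrix (Fin 2) (Fin 2) k) {x₁ : Fin 2 → k} (h₀ : ∃ i₀, I i₀ ∧ S i₀ ≠ 1) (hx₁ : x₁ ≠ 0)
    (hfix₁ : ∀ i, I i → S i *ᵥ x₁ = x₁) (x : Fin 2 → k) (hfix : ∀ i, I i → S i *ᵥ x = x) :
    ∃ e : k, x = e • x₁ := by
  obtain ⟨i₀, hI₀, hS₀⟩ := h₀
  refine exists_eq_smul_of_mulVec_eq_zero (S i₀ - 1) (sub_ne_zero.2 hS₀) hx₁ ?_ ?_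
  · rw [Matrix.sub_mulVec, Matrix.one_mulVec, hfix₁ i₀ hI₀, sub_self]
  · rw [Matrix.sub_mulVec, Matrix.one_mulVec, hfix i₀ hI₀, sub_self]

/-- **Stub GL `stub_greenbergDecIntrinsic`** (hygiene for "rank"): fix families `S, S' : ι → M₂(k)` (think `σ̄(res τ)`,
`σ̄'(res τ)` for `τ : Γ_{ℚ_v}`) and an inertia predicate `I`.  (i) The `A`-dependent clauses of the decomposition-group
Greenberg condition with respect to fixed lines `x₁, y₁` — `(A - δX) y₁ ∈ k x₁` everywhere, `(A - δX) y₁ = 0` and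
`(A - δX)(k²) ⊆ k x₁` on `I` — are LINEAR: they pass from `(A₁, X₁)`, `(A₂, X₂)` to `(c • A₁ + A₂, c • X₁ + X₂)`, and they
hold for every coboundary `(S X - X S', X)`; (ii) if inertia moves `σ̄` (`S i₀ ≠ 1` for some `I i₀`) then a non-zero
inertia-fixed `x₁` spans the WHOLE fixed space (`S i x = x` on `I` → `x ∈ k x₁`), and likewise for `σ̄'`: the Greenberg
lines are unique, so the condition depends only on the class of `A` and the strong Greenberg–Selmer cocycles form a
`k`-subspace containing the coboundaries. [folklore] -/
theorem stub_greenbergDecIntrinsic :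
    ∀ (k : Type) [Field k] (ι : Type) (I : ι → Prop) (S S' : ι → Matrix (Fin 2) (Fin 2) k) (x₁ y₁ : Fin 2 → k),
      (∀ (A₁ A₂ : ι → Matrix (Fin 2) (Fin 2) k) (X₁ X₂ : Matrix (Fin 2) (Fin 2) k) (c : k),
        ((∀ i, ∃ e : k, (A₁ i - (S i * X₁ - X₁ * S' i)) *ᵥ y₁ = e • x₁) ∧
          (∀ i, I i → (A₁ i - (S i * X₁ - X₁ * S' i)) *ᵥ y₁ = 0) ∧
          (∀ i, I i → ∀ y : Fin 2 → k, ∃ e : k, (A₁ i - (S i * X₁ - X₁ * S' i)) *ᵥ y = e • x₁)) →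
        ((∀ i, ∃ e : k, (A₂ i - (S i * X₂ - X₂ * S' i)) *ᵥ y₁ = e • x₁) ∧
          (∀ i, I i → (A₂ i - (S i * X₂ - X₂ * S' i)) *ᵥ y₁ = 0) ∧
          (∀ i, I i → ∀ y : Fin 2 → k, ∃ e : k, (A₂ i - (S i * X₂ - X₂ * S' i)) *ᵥ y = e • x₁)) →
        (∀ i, ∃ e : k, ((c • A₁ i + A₂ i) - (S i * (c • X₁ + X₂) - (c • X₁ + X₂) * S' i)) *ᵥ y₁ = e • x₁) ∧
          (∀ i, I i → ((c • A₁ i + A₂ i) - (S i * (c • X₁ + X₂) - (c • X₁ + X₂) * S' i)) *ᵥ y₁ = 0) ∧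
          (∀ i, I i → ∀ y : Fin 2 → k, ∃ e : k,
            ((c • A₁ i + A₂ i) - (S i * (c • X₁ + X₂) - (c • X₁ + X₂) * S' i)) *ᵥ y = e • x₁)) ∧
      (∀ X : Matrix (Fin 2) (Fin 2) k,
        (∀ i, ∃ e : k, ((S i * X - X * S' i) - (S i * X - X * S' i)) *ᵥ y₁ = e • x₁) ∧
          (∀ i, I i → ((S i * X - X * S' i) - (S i * X - X * S' i)) *ᵥ y₁ = 0) ∧
          (∀ i, I i → ∀ y : Fin 2 → k, ∃ e : k, ((S i * X - X * S' i) - (S i * X - X * S' i)) *ᵥ y = e • x₁)) ∧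
      ((∃ i₀, I i₀ ∧ S i₀ ≠ 1) → x₁ ≠ 0 → (∀ i, I i → S i *ᵥ x₁ = x₁) →
        ∀ x : Fin 2 → k, (∀ i, I i → S i *ᵥ x = x) → ∃ e : k, x = e • x₁) ∧
      ((∃ i₀, I i₀ ∧ S' i₀ ≠ 1) → y₁ ≠ 0 → (∀ i, I i → S' i *ᵥ y₁ = y₁) →
        ∀ y : Fin 2 → k, (∀ i, I i → S' i *ᵥ y = y) → ∃ e : k, y = e • y₁) := by
  intro k _ ι I S S' x₁ y₁
  refine ⟨fun A₁ A₂ X₁ X₂ c h₁ h₂ ↦ ?_, fun X ↦ ?_, exists_eq_smul_of_fixed I S, exists_eq_smul_of_fixed I S'⟩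
  · -- (LIN): the corrected matrix of `(c • A₁ + A₂, c • X₁ + X₂)` is `c • A₁' i + A₂' i`
    have key : ∀ i, (c • A₁ i + A₂ i) - (S i * (c • X₁ + X₂) - (c • X₁ + X₂) * S' i) =
        c • (A₁ i - (S i * X₁ - X₁ * S' i)) + (A₂ i - (S i * X₂ - X₂ * S' i)) := fun i ↦ by
      rw [Matrix.mul_add, Matrix.add_mul, Matrix.mul_smul, Matrix.smul_mul, smul_sub, smul_sub]
      abel
    obtain ⟨h₁a, h₁b, h₁c⟩ := h₁
    obtain ⟨h₂a, h₂b, h₂c⟩ := h₂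
    refine ⟨fun i ↦ ?_, fun i hi ↦ ?_, fun i hi y ↦ ?_⟩
    · obtain ⟨e₁, he₁⟩ := h₁a i
      obtain ⟨e₂, he₂⟩ := h₂a i
      refine ⟨c * e₁ + e₂, ?_⟩
      rw [key, Matrix.add_mulVec, Matrix.smul_mulVec, he₁, he₂, add_smul, smul_smul]
    · rw [key, Matrix.add_mulVec, Matrix.smul_mulVec, h₁b i hi, h₂b i hi, smul_zero, add_zero]
    · obtain ⟨e₁, he₁⟩ := h₁c i hi y
      obtain ⟨e₂, he₂⟩ := h₂c i hi y
      refine ⟨c * e₁ + e₂, ?_⟩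
      rw [key, Matrix.add_mulVec, Matrix.smul_mulVec, he₁, he₂, add_smul, smul_smul]
  · -- (COB): the corrected matrix of a coboundary is `0`
    refine ⟨fun i ↦ ⟨0, ?_⟩, fun i _ ↦ ?_, fun i _ y ↦ ⟨0, ?_⟩⟩
    · rw [sub_self, Matrix.zero_mulVec, zero_smul]
    · rw [sub_self, Matrix.zero_mulVec]
    · rw [sub_self, Matrix.zero_mulVec, zero_smul]

end Summit.Langlands.Langlands.Cruxes.ResiduallyYoshidaLifting.SectorKlingenSplit.Fibre
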